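import Mathlib
import HarnessLib
import Literature.Analysis.FluidPDE.TaoAveragedNondegeneracy
import Literature.Analysis.FluidPDE.VectorCalculus
import Summits.NavierStokesRegularity.NavierStokesRegularity.Theorems.UnthreadedDoorNetFluxDefs
import Summits.NavierStokesRegularity.NavierStokesRegularity.Theorems.UnthreadedDoorNetFluxEnvelopeDefs
import Summits.NavierStokesRegularity.NavierStokesRegularity.Theorems.UnthreadedDoorNetFluxEnvelopeToolkit
import Summits.NavierStokesRegularity.NavierStokesRegularity.Theorems.UnthreadedDoorNetFluxEnvelopeRegularity
import Summits.NavierStokesRegularity.NavierStokesRegularity.Theorems.UnthreadedDoorNetFluxNearCentreComparison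
import Summits.NavierStokesRegularity.NavierStokesRegularity.Theorems.UnthreadedDoorNetFluxOscLeVorticity

/-!
# Route `UnthreadedDoor`, crux `PoloidalLiouville` (stmt-NavierStokesRegularity-1222), WALL W1 — netflux line,
# NF-1a: tools for the JOINT CONTINUITY of the extremal head difference (part (ii) of `ExtremalHeadEMF`)

Part of the proof of the research stub NF-1a `stub_extremalHeadEMF` (`NetFlux.ExtremalHeadEMF`).  The extremal head difference
`I(t,r) = P(t,x⁺) − P(t,x⁻)` involves a head `P` with NO regularity in `t`; its continuity in `(t,r)` is obtained WITHOUT line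
integrals, from the great-circle oscillation lemma `sub_le_pi_mul_of_norm_cross_gradient_le` (NF-0 file, p660776) applied to the
difference `D = P_t − P_{t₁} ∘ σ` (`σ` the radial scaling `S_r → S_{r₁}`), whose tangential gradient is expressed through `v, T` only.
This file supplies the ingredients:

* `continuousOn_gradient_family` — `(t,x) ↦ ∇(T t)(x)` is continuous on the window for `T` jointly smooth off the centre;
* `gradient_comp_radialScaling` — `∇(P ∘ σ)(x) = c ∇P(σ x)` for `σ x = x₀ + c (x − x₀)`;
* `cross_gradient_eq_smul_of_head` — the head relation `∇P − m∇T ∥ y` gives `∇P × y = m (∇T × y)`;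
* `abs_sphSup_sub_le_of_forall` / `abs_sphInf_sub_le_of_forall` — if `|T(x₀ + rξ) − T'(x₀ + r'ξ)| ≤ ε` for all unit `ξ` then
  the spherical maxima (minima) of `T` on `S_r` and of `T'` on `S_{r'}` differ by at most `ε`;
* `isCompact_eventually_forall_sphere` — the tube-lemma form used: a property holding eventually near `(p₁, ξ)` for every unit `ξ`
  holds, for `p` near `p₁`, for all unit `ξ` simultaneously (`IsCompact.eventually_forall_of_forall_eventually`).

WHAT THIS IS NOT: no NS statement; `PoloidalLiouville` (1222), W1, the line's rung and NF-1a itself stay OPEN here.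
`--supports stmt-NavierStokesRegularity-1222 --as helper`.  [folklore]
-/

noncomputable section

-- the summit and its single sub-problem share the name (CONVENTIONS §1)
set_option linter.dupNamespace false

open Set Function Filter Topology InnerProductSpace MeasureTheory Metric
open scoped RealInnerProductSpace ContDiff

namespace Summit.NavierStokesRegularity.NavierStokesRegularity.Theorems.PoloidalLiouville.NetFlux

open Literature.Analysis Literature.Analysis.FluidPDE

/-! ### Joint continuity of the spatial gradient of a jointly smooth family -/

/-- For `T` jointly `C^∞` on `]t₀,0[ × (ℝ³ ∖ {x₀})`, the spatial gradient `(t,x) ↦ ∇(T t)(x)` is continuous there. [folklore] -/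
theorem continuousOn_gradient_family {T : ℝ → E3 → ℝ} {x₀ : E3} {t₀ : ℝ}
    (hT : ContDiffOn ℝ (⊤ : ℕ∞) (uncurry T) (Ioo t₀ 0 ×ˢ ({x₀}ᶜ : Set E3))) :
    ContinuousOn (fun q : ℝ × E3 => gradient (T q.1) q.2) (Ioo t₀ 0 ×ˢ ({x₀}ᶜ : Set E3)) := by
  have hopen : IsOpen (Ioo t₀ 0 ×ˢ ({x₀}ᶜ : Set E3)) := isOpen_Ioo.prod isOpen_compl_singleton
  have hT1 : ContDiffOn ℝ 1 (uncurry T) (Ioo t₀ 0 ×ˢ ({x₀}ᶜ : Set E3)) := hT.of_le (by exact_mod_cast le_top)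
  have hfc : ContinuousOn (fun q => fderiv ℝ (uncurry T) q) (Ioo t₀ 0 ×ˢ ({x₀}ᶜ : Set E3)) :=
    hT1.continuousOn_fderiv_of_isOpen hopen le_rfl
  -- the slice derivative is the joint derivative composed with `inr`
  have hslice : ∀ q ∈ Ioo t₀ 0 ×ˢ ({x₀}ᶜ : Set E3),
      fderiv ℝ (T q.1) q.2 = (fderiv ℝ (uncurry T) q).comp (ContinuousLinearMap.inr ℝ ℝ E3) := by
    rintro ⟨t, x⟩ hq
    have hd : DifferentiableAt ℝ (uncurry T) (t, x) := (hT1.differentiableOn one_ne_zero _ hq).differentiableAt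
      (hopen.mem_nhds hq)
    have hc : HasFDerivAt (fun y : E3 => uncurry T (t, y)) ((fderiv ℝ (uncurry T) (t, x)).comp
        (ContinuousLinearMap.inr ℝ ℝ E3)) x := hd.hasFDerivAt.comp x (hasFDerivAt_prodMk_right t x)
    exact hc.fderiv
  have hcomp : ContinuousOn (fun q : ℝ × E3 => (fderiv ℝ (uncurry T) q).comp (ContinuousLinearMap.inr ℝ ℝ E3))
      (Ioo t₀ 0 ×ˢ ({x₀}ᶜ : Set E3)) := hfc.clm_comp continuousOn_const
  have e : ∀ q : ℝ × E3, gradient (T q.1) q.2 = (InnerProductSpace.toDual ℝ E3).symm (fderiv ℝ (T q.1) q.2) := fun q => rfl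
  refine ((InnerProductSpace.toDual ℝ E3).symm.continuous.comp_continuousOn hcomp).congr fun q hq => ?_
  show gradient (T q.1) q.2 = _
  rw [e q, hslice q hq]
  rfl

/-- Slices of a jointly smooth `v : ]t₀,0[ × ℝ³ → ℝ³` are smooth. [folklore] -/
theorem contDiff_slice_of_uncurry {v : ℝ → E3 → E3} {t₀ : ℝ} (hv : ContDiffOn ℝ (⊤ : ℕ∞) (uncurry v) (Ioo t₀ 0 ×ˢ univ))
    {t : ℝ} (ht : t ∈ Ioo t₀ 0) : ContDiff ℝ (⊤ : ℕ∞) (v t) :=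
  contDiffOn_univ.1 (hv.comp (contDiff_prodMk_right t).contDiffOn fun x _ => ⟨ht, mem_univ x⟩)

/-! ### Gradients: radial scaling, the head relation -/

/-- `∇(P ∘ σ)(x) = c • ∇P(σ x)` for the radial scaling `σ x = x₀ + c (x − x₀)`. [folklore] -/
theorem gradient_comp_radialScaling {P : E3 → ℝ} {x₀ x : E3} {c : ℝ}
    (hP : DifferentiableAt ℝ P (x₀ + c • (x - x₀))) :
    gradient (fun z => P (x₀ + c • (z - x₀))) x = c • gradient P (x₀ + c • (x - x₀)) := by
  have hσ : HasFDerivAt (fun z : E3 => x₀ + c • (z - x₀)) (c • ContinuousLinearMap.id ℝ E3) x := by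
    have h1 : HasFDerivAt (fun z : E3 => c • (z - x₀)) (c • ContinuousLinearMap.id ℝ E3) x :=
      ((hasFDerivAt_id x).sub_const x₀).const_smul c
    exact h1.const_add x₀
  have hc : HasFDerivAt (fun z => P (x₀ + c • (z - x₀))) ((fderiv ℝ P (x₀ + c • (x - x₀))).comp
      (c • ContinuousLinearMap.id ℝ E3)) x := hP.hasFDerivAt.comp x hσ
  have e : ∀ φ : E3 → ℝ, ∀ z : E3, gradient φ z = (InnerProductSpace.toDual ℝ E3).symm (fderiv ℝ φ z) := fun _ _ => rfl
  rw [e, e, hc.fderiv, ContinuousLinearMap.comp_smul, ContinuousLinearMap.comp_id, map_smul]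

/-- The head relation `∇P − m∇T ∥ y` in the form `∇P × y = m (∇T × y)`. [folklore] -/
theorem cross_gradient_eq_smul_of_head {gP gT y : E3} {m : ℝ} (h : cross (gP - m • gT) y = 0) :
    cross gP y = m • cross gT y := by
  rwa [cross_sub_left', Tao2016.cross_smul_left, sub_eq_zero] at h

/-! ### Spherical extrema under uniform closeness along rays -/

section SupCompare

variable {T T' : E3 → ℝ} {x₀ : E3} {r r' ε : ℝ}

/-- Unit directions and points of spheres. [folklore] -/
theorem exists_unit_eq_of_mem_sphere (hr : 0 < r) {x : E3} (hx : x ∈ Metric.sphere x₀ r) :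
    ∃ ξ : E3, ‖ξ‖ = 1 ∧ x = x₀ + r • ξ := by
  refine ⟨r⁻¹ • (x - x₀), ?_, ?_⟩
  · rw [norm_smul, norm_inv, Real.norm_eq_abs, abs_of_pos hr, mem_sphere_iff_norm.1 hx, inv_mul_cancel₀ hr.ne']
  · rw [smul_smul, mul_inv_cancel₀ hr.ne', one_smul, add_sub_cancel]

/-- `x₀ + r ξ ∈ S_r(x₀)` for unit `ξ` and `r > 0`. [folklore] -/
theorem add_smul_mem_sphere (hr : 0 < r) {ξ : E3} (hξ : ‖ξ‖ = 1) : x₀ + r • ξ ∈ Metric.sphere x₀ r := by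
  rw [mem_sphere_iff_norm, add_sub_cancel_left, norm_smul, hξ, mul_one, Real.norm_eq_abs, abs_of_pos hr]

/-- If `|T(x₀ + rξ) − T'(x₀ + r'ξ)| ≤ ε` for every unit `ξ`, the spherical MAXIMA differ by at most `ε`. [folklore] -/
theorem abs_sphSup_sub_le_of_forall (hr : 0 < r) (hr' : 0 < r') (hT : ContinuousOn T (Metric.sphere x₀ r))
    (hT' : ContinuousOn T' (Metric.sphere x₀ r'))
    (h : ∀ ξ : E3, ‖ξ‖ = 1 → |T (x₀ + r • ξ) - T' (x₀ + r' • ξ)| ≤ ε) :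
    |sphSup T x₀ r - sphSup T' x₀ r'| ≤ ε := by
  obtain ⟨x, hx, hxe⟩ := exists_eq_sphSup hT hr.le
  obtain ⟨x', hx', hxe'⟩ := exists_eq_sphSup hT' hr'.le
  obtain ⟨ξ, hξ, rfl⟩ := exists_unit_eq_of_mem_sphere hr hx
  obtain ⟨ξ', hξ', rfl⟩ := exists_unit_eq_of_mem_sphere hr' hx'
  have h1 := h ξ hξ
  have h2 := h ξ' hξ'
  have h3 := le_sphSup hT' (add_smul_mem_sphere hr' hξ)
  have h4 := le_sphSup hT (add_smul_mem_sphere hr hξ')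
  rw [abs_le] at h1 h2 ⊢
  rw [← hxe, ← hxe'] at *
  constructor <;> linarith

/-- If `|T(x₀ + rξ) − T'(x₀ + r'ξ)| ≤ ε` for every unit `ξ`, the spherical MINIMA differ by at most `ε`. [folklore] -/
theorem abs_sphInf_sub_le_of_forall (hr : 0 < r) (hr' : 0 < r') (hT : ContinuousOn T (Metric.sphere x₀ r))
    (hT' : ContinuousOn T' (Metric.sphere x₀ r'))
    (h : ∀ ξ : E3, ‖ξ‖ = 1 → |T (x₀ + r • ξ) - T' (x₀ + r' • ξ)| ≤ ε) :
    |sphInf T x₀ r - sphInf T' x₀ r'| ≤ ε := by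
  have hmin : ∀ {U : E3 → ℝ} {ρ : ℝ}, 0 < ρ → ContinuousOn U (Metric.sphere x₀ ρ) →
      ∃ x ∈ Metric.sphere x₀ ρ, sphInf U x₀ ρ = U x ∧ ∀ y ∈ Metric.sphere x₀ ρ, U x ≤ U y := by
    intro U ρ hρ hU
    obtain ⟨x, hx, hle⟩ := (isCompact_sphere x₀ ρ).exists_isMinOn (NormedSpace.sphere_nonempty.2 hρ.le) hU
    refine ⟨x, hx, ?_, fun y hy => hle hy⟩
    refine le_antisymm (csInf_le ((isCompact_sphere x₀ ρ).bddBelow_image hU) ⟨x, hx, rfl⟩) ?_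
    exact le_csInf ⟨U x, x, hx, rfl⟩ (by rintro _ ⟨y, hy, rfl⟩; exact hle hy)
  obtain ⟨x, hx, hxe, hxle⟩ := hmin hr hT
  obtain ⟨x', hx', hxe', hxle'⟩ := hmin hr' hT'
  obtain ⟨ξ, hξ, rfl⟩ := exists_unit_eq_of_mem_sphere hr hx
  obtain ⟨ξ', hξ', rfl⟩ := exists_unit_eq_of_mem_sphere hr' hx'
  have h1 := h ξ hξ
  have h2 := h ξ' hξ'
  have h3 := hxle' _ (add_smul_mem_sphere hr' hξ)
  have h4 := hxle _ (add_smul_mem_sphere hr hξ')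
  rw [abs_le] at h1 h2 ⊢
  rw [hxe, hxe']
  constructor <;> linarith

end SupCompare

/-! ### The tube lemma over the unit sphere -/

/-- A property holding eventually near `(p₁, ξ)` for each unit vector `ξ` holds, for `p` near `p₁`, for all unit `ξ` at once
(the unit sphere is compact). [folklore] -/
theorem isCompact_eventually_forall_sphere {X : Type*} [TopologicalSpace X] {p₁ : X} {Q : X → E3 → Prop}
    (h : ∀ ξ ∈ Metric.sphere (0 : E3) 1, ∀ᶠ z : X × E3 in 𝓝 (p₁, ξ), Q z.1 z.2) :
    ∀ᶠ p in 𝓝 p₁, ∀ ξ ∈ Metric.sphere (0 : E3) 1, Q p ξ :=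
  (isCompact_sphere (0 : E3) 1).eventually_forall_of_forall_eventually h

end Summit.NavierStokesRegularity.NavierStokesRegularity.Theorems.PoloidalLiouville.NetFlux

end
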